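import Literature.Probability.LatticeModels.LoopErasedWalkIdentity
import Mathlib.Combinatorics.SimpleGraph.Walk.Maps

/-!
# First-exit decomposition of killed-walk Green's functions (strong Markov property for walk sums)
— support file for `SAWChargeContinuation.AnchorExcursion` (stmt-CriticalPhenomena-11196), step 1
of the blueprint for its missing lattice → continuum input

For a simple graph `G`, a step weight `r ∈ ℝ≥0∞`, a set of vertices `B` and an endpoint `y ∉ B`,
every walk `x → y` splits uniquely at its FIRST vertex `z` outside `B` into a prefix `x → z` whose
vertices other than the last lie in `B`, and an arbitrary suffix `z → y`; the weight `r^{|ω|}` is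
multiplicative. Hence (`tsum_walk_eq_tsum_exit`)

  `Σ_{ω : x → y} r^{|ω|} = Σ_z e_B(x, z) · Σ_{s : z → y} r^{|s|}`,
  `e_B(x, z) = Σ_{q : x → z, q minus its endpoint ⊆ B, z ∉ B} r^{|q|}`

(the exit "distribution" of the killed walk from `x` out of `B`, un-normalised; written inline as a
`tsum`, no definition is introduced). For the Type II simple-random-walk weight `r = 1/4` on a
sub-graph `H` of `ℤ²` this is the last display of Lawler 2018 §2 / Lawler–Limic 2010 §4.6 (strong
Markov property at the exit time of `B`) for the Green's function `rwGreen` of the tree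
(`rwGreen_eq_tsum_exit`), and the exit weights only see the edges of `H` with an endpoint in `B`
(`tsum_exit_eq_of_adj_iff`): two graphs that agree near `x` have the SAME exit weights, so the ratio
of their Green's functions `G_{H'}(x,y)/G_H(x,y)` depends on the microscopic position of `x` only
through a common averaging measure (`rwGreen_eq_tsum_exit_of_adj_iff`). With the symmetry
`rwGreen_comm` the same holds at `y`. This is step 1 (exact, lattice) of the proof plan for the
Green's-ratio invariance principle to which `AnchorExcursion` has been reduced
(`anchorExcursion_of_greenRatioInvariance`).

Proof: vertex lists (`LoopErasedWalkIdentity.tsum_walk_eq_tsum_list`), the splitting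
`l = l.takeWhile (∈ B) ++ l.dropWhile (∈ B)`, and unconditional `ℝ≥0∞` sum manipulations.

Sources: G. F. Lawler, V. Limic, *Random Walk: A Modern Introduction* (2010), §4.6 (Green's
function and exit times; strong Markov) [LawlerLimic2010]; G. F. Lawler, *Topics in loop measures
and the loop-erased walk* (2018), §2 [Lawler2018]. Folklore. No definitions.
-/

noncomputable section

open scoped ENNReal Classical
open Literature.Probability.RandomPlanarGeometry Literature.Probability.LatticeModels

namespace Summit.CriticalPhenomena.SAWScalingLimit.Theorems.AnchorExcursion

namespace ExitSplit

variable {V : Type*}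

/-! ## Splitting a list at its first element outside `B` -/

/-- The splitting map `(p, s) ↦ p ++ s` is injective on pairs with `p ⊆ B` and `s` non-empty with
head outside `B` (the prefix is recovered as `takeWhile (∈ B)`). [folklore] -/
theorem append_injective_of_split (B : Set V) :
    Function.Injective (fun c : {p : List V // ∀ v ∈ p, v ∈ B} ×
        {s : List V // ∃ h : s ≠ [], s.head h ∉ B} => c.1.1 ++ c.2.1) := by
  rintro ⟨⟨p, hp⟩, ⟨s, hs⟩⟩ ⟨⟨p', hp'⟩, ⟨s', hs'⟩⟩ h
  simp only at h
  have key : ∀ (p s : List V), (∀ v ∈ p, v ∈ B) → (∃ h : s ≠ [], s.head h ∉ B) →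
      (p ++ s).takeWhile (fun v => decide (v ∈ B)) = p := by
    intro p s hp hs
    obtain ⟨hne, hhead⟩ := hs
    rw [List.takeWhile_append_of_pos (fun a ha => by simpa using hp a ha)]
    obtain ⟨z, t, rfl⟩ := List.exists_cons_of_ne_nil hne
    rw [List.takeWhile_cons_of_neg (by simpa using hhead), List.append_nil]
  have hpp : p = p' := by rw [← key p s hp hs, h, key p' s' hp' hs']
  subst hpp
  have hss : s = s' := List.append_cancel_left h
  subst hss
  rfl

/-- Every list containing an element outside `B` is in the range of the splitting map. [folklore] -/
theorem exists_split_of_mem {B : Set V} {l : List V} {y : V} (hy : y ∈ l) (hyB : y ∉ B) :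
    ∃ c : {p : List V // ∀ v ∈ p, v ∈ B} × {s : List V // ∃ h : s ≠ [], s.head h ∉ B},
      c.1.1 ++ c.2.1 = l := by
  have hne : l.dropWhile (fun v => decide (v ∈ B)) ≠ [] := by
    intro h
    rw [List.dropWhile_eq_nil_iff] at h
    exact hyB (by simpa using h y hy)
  refine ⟨(⟨l.takeWhile (fun v => decide (v ∈ B)), fun v hv => by
      simpa using List.mem_takeWhile_imp hv⟩,
    ⟨l.dropWhile (fun v => decide (v ∈ B)), hne, by
      simpa using List.head_dropWhile_not (fun v => decide (v ∈ B)) hne⟩), ?_⟩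
  exact List.takeWhile_append_dropWhile

/-! ## The first-exit decomposition for vertex lists -/

variable (G : SimpleGraph V) (r : ℝ≥0∞)

/-- The weight of the chains from `x` to `y`: `Σ_{l chain, head x, last y} r^{|l|-1}`, i.e. the
walk sum `Σ_{ω : x → y} r^{|ω|}` (`LoopErasedWalkIdentity.tsum_walk_eq_tsum_list`). [folklore] -/
theorem tsum_walk_pow_eq_tsum_list (x y : V) :
    ∑' ω : G.Walk x y, r ^ ω.length =
      ∑' l : List V, if l.IsChain G.Adj ∧ l.head? = some x ∧ l.getLast? = some y then
        r ^ (l.length - 1) else 0 :=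
  LoopErasedWalkIdentity.tsum_walk_eq_tsum_list G x y (fun _ n => r ^ n)

/-- **First-exit decomposition, list form.** For `y ∉ B`, the chain sum from `x` to `y` splits
over the first vertex `z ∉ B`: prefix `p ⊆ B` followed by `z` (a chain from `x`), times an
arbitrary chain from `z` to `y`. [cite: LawlerLimic2010, §4.6] -/
theorem tsum_list_eq_tsum_exit (B : Set V) {x y : V} (hy : y ∉ B) :
    (∑' l : List V, if l.IsChain G.Adj ∧ l.head? = some x ∧ l.getLast? = some y then
        r ^ (l.length - 1) else 0) =
      ∑' z : V, (∑' p : List V, if (p ++ [z]).IsChain G.Adj ∧ (p ++ [z]).head? = some x ∧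
          (∀ v ∈ p, v ∈ B) ∧ z ∉ B then r ^ p.length else 0) *
        ∑' s : List V, if s.IsChain G.Adj ∧ s.head? = some z ∧ s.getLast? = some y then
          r ^ (s.length - 1) else 0 := by
  -- the summand, as a function of the list
  set F : List V → ℝ≥0∞ := fun l =>
    if l.IsChain G.Adj ∧ l.head? = some x ∧ l.getLast? = some y then r ^ (l.length - 1) else 0
    with hF
  -- reindex by the splitting map
  have hsupp : Function.support F ⊆ Set.range (fun c : {p : List V // ∀ v ∈ p, v ∈ B} ×
      {s : List V // ∃ h : s ≠ [], s.head h ∉ B} => c.1.1 ++ c.2.1) := by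
    intro l hl
    have hl' : l.IsChain G.Adj ∧ l.head? = some x ∧ l.getLast? = some y := by
      by_contra h
      exact hl (by simp only [hF, if_neg h])
    exact exists_split_of_mem (List.mem_of_getLast? hl'.2.2) hy
  rw [← (append_injective_of_split B).tsum_eq hsupp, ENNReal.tsum_prod']
  rw [LoopErasedWalkIdentity.tsum_subtype_eq_tsum_ite (fun p : List V => ∀ v ∈ p, v ∈ B)
    (fun p => ∑' s : {s : List V // ∃ h : s ≠ [], s.head h ∉ B}, F (p ++ s.1))]
  have inner : ∀ p : List V, (∑' s : {s : List V // ∃ h : s ≠ [], s.head h ∉ B}, F (p ++ s.1)) =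
      ∑' s : List V, if (∃ h : s ≠ [], s.head h ∉ B) then F (p ++ s) else 0 := fun p => by
    rw [LoopErasedWalkIdentity.tsum_subtype_eq_tsum_ite (fun s : List V => ∃ h : s ≠ [], s.head h ∉ B)
      (fun s => F (p ++ s))]
    exact tsum_congr fun s => LoopErasedWalkIdentity.ite_congr_prop _ _ Iff.rfl
  simp only [inner]
  -- introduce the exit vertex `z = head s` and swap the sums
  have fiber : ∀ (p s : List V), (if (∃ h : s ≠ [], s.head h ∉ B) then F (p ++ s) else 0) =
      ∑' z : V, if s.head? = some z ∧ z ∉ B then F (p ++ s) else 0 := by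
    intro p s
    cases s with
    | nil => simp
    | cons z t =>
      rw [tsum_eq_single z]
      · simp
      · intro z' hz'
        rw [if_neg]
        rintro ⟨h, -⟩
        simp only [List.head?_cons, Option.some.injEq] at h
        exact hz' h.symm
  simp only [fiber]
  have swap1 : ∀ p : List V, (∑' s : List V, ∑' z : V,
      if s.head? = some z ∧ z ∉ B then F (p ++ s) else 0) =
      ∑' z : V, ∑' s : List V, if s.head? = some z ∧ z ∉ B then F (p ++ s) else 0 :=
    fun p => ENNReal.tsum_comm
  simp only [swap1]
  rw [show (∑' p : List V, if (∀ v ∈ p, v ∈ B) then ∑' z : V, ∑' s : List V,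
      if s.head? = some z ∧ z ∉ B then F (p ++ s) else 0 else 0) =
      ∑' p : List V, ∑' z : V, ∑' s : List V, if (∀ v ∈ p, v ∈ B) then
        (if s.head? = some z ∧ z ∉ B then F (p ++ s) else 0) else 0 from
    tsum_congr fun p => by split_ifs <;> simp, ENNReal.tsum_comm]
  refine tsum_congr fun z => ?_
  rw [← ENNReal.tsum_mul_right]
  refine tsum_congr fun p => ?_
  rw [← ENNReal.tsum_mul_left]
  refine tsum_congr fun s => ?_
  -- the summand factorises
  by_cases hp : ∀ v ∈ p, v ∈ B
  · rw [if_pos hp]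
    by_cases hs : s.head? = some z ∧ z ∉ B
    · rw [if_pos hs]
      obtain ⟨hsz, hzB⟩ := hs
      have hsne : s ≠ [] := by rintro rfl; simp at hsz
      simp only [hF]
      have hlast : (p ++ s).getLast? = s.getLast? := by
        rw [List.getLast?_append]
        obtain ⟨w, hw⟩ := List.getLast?_isSome.2 hsne |> Option.isSome_iff_exists.1
        rw [hw]; rfl
      have hhead : (p ++ s).head? = (p ++ [z]).head? := by
        rw [List.head?_append, List.head?_append, hsz]; rfl
      have hchain : (p ++ s).IsChain G.Adj ↔ (p ++ [z]).IsChain G.Adj ∧ s.IsChain G.Adj := by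
        rw [List.isChain_append, List.isChain_append]
        simp only [List.isChain_singleton, true_and, List.head?_cons, Option.mem_def,
          Option.some.injEq, forall_eq', hsz]
        tauto
      have hlen : (p ++ s).length - 1 = p.length + (s.length - 1) := by
        rw [List.length_append]
        have := List.length_pos_iff.2 hsne
        omega
      by_cases h1 : (p ++ [z]).IsChain G.Adj ∧ (p ++ [z]).head? = some x
      · by_cases h2 : s.IsChain G.Adj ∧ s.head? = some z ∧ s.getLast? = some y
        · rw [if_pos ⟨hchain.2 ⟨h1.1, h2.1⟩, hhead.trans h1.2, hlast.trans h2.2.2⟩,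
            if_pos ⟨h1.1, h1.2, hp, hzB⟩, if_pos h2, hlen, pow_add]
        · rw [if_neg, if_neg h2, mul_zero]
          rintro ⟨hc, -, hl⟩
          exact h2 ⟨(hchain.1 hc).2, hsz, hlast ▸ hl⟩
      · rw [if_neg, if_neg (fun h => h1 ⟨h.1, h.2.1⟩), zero_mul]
        rintro ⟨hc, hh, -⟩
        exact h1 ⟨(hchain.1 hc).1, hhead ▸ hh⟩
    · rw [if_neg hs]
      by_cases hzB : z ∉ B
      · have hsz : s.head? ≠ some z := fun h => hs ⟨h, hzB⟩
        have hC : ¬ (s.IsChain G.Adj ∧ s.head? = some z ∧ s.getLast? = some y) :=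
          fun h => hsz h.2.1
        rw [if_neg hC, mul_zero]
      · rw [if_neg (fun h => hzB h.2.2.2), zero_mul]
  · rw [if_neg hp, if_neg (fun h => hp h.2.2.1), zero_mul]

/-! ## The first-exit decomposition for walk sums and for `rwGreen` -/

/-- **First-exit decomposition of the walk sum (strong Markov at the exit time of `B`).** For
`y ∉ B`: `Σ_{ω : x → y} r^{|ω|} = Σ_z e_B(x,z) · Σ_{s : z → y} r^{|s|}`, where
`e_B(x,z) = Σ_{q : x → z, support q minus its endpoint ⊆ B, z ∉ B} r^{|q|}` is the (un-normalised)
exit weight of the killed walk from `x` out of `B`. [cite: LawlerLimic2010, §4.6] -/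
theorem tsum_walk_eq_tsum_exit (B : Set V) {x y : V} (hy : y ∉ B) :
    ∑' ω : G.Walk x y, r ^ ω.length =
      ∑' z : V, (∑' q : G.Walk x z, if (∀ v ∈ q.support.dropLast, v ∈ B) ∧ z ∉ B then
          r ^ q.length else 0) * ∑' s : G.Walk z y, r ^ s.length := by
  rw [tsum_walk_pow_eq_tsum_list, tsum_list_eq_tsum_exit G r B hy]
  refine tsum_congr fun z => ?_
  congr 1
  · -- the prefix sum: walks `x → z` are the lists `p ++ [z]`
    symm
    rw [LoopErasedWalkIdentity.tsum_walk_eq_tsum_list G x z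
      (fun w n => if (∀ v ∈ w.dropLast, v ∈ B) ∧ z ∉ B then r ^ n else 0)]
    conv_lhs => rw [LoopErasedWalkIdentity.tsum_eq_tsum_concat z _ (by
      intro t ht
      by_contra hne
      exact ht (by rw [if_neg (fun h => hne h.2.2)]))]
    refine tsum_congr fun p => ?_
    simp only [List.getLast?_concat, and_true, List.dropLast_concat, List.length_append,
      List.length_singleton, Nat.add_sub_cancel]
    by_cases h : (p ++ [z]).IsChain G.Adj ∧ (p ++ [z]).head? = some x
    · rw [if_pos h]
      by_cases h' : (∀ v ∈ p, v ∈ B) ∧ z ∉ B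
      · rw [if_pos h', if_pos ⟨h.1, h.2, h'.1, h'.2⟩]
      · rw [if_neg h', if_neg (fun hh => h' ⟨hh.2.2.1, hh.2.2.2⟩)]
    · rw [if_neg h, if_neg (fun hh => h ⟨hh.1, hh.2.1⟩)]
  · exact (tsum_walk_pow_eq_tsum_list G r z y).symm

end ExitSplit

/-! ## Specialisation to the killed simple random walk on a sub-graph of `ℤ²` -/

section Lattice

variable {H H' : SimpleGraph (Site 2)} {a b : Site 2}

/-- **`G_H(a, b) = Σ_z e_B(a, z) G_H(z, b)` for `b ∉ B`**: the first-exit decomposition of the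
Green's function of the simple random walk killed off `H` (weight `1/4` per step), at the exit
time of `B`. [cite: LawlerLimic2010, §4.6] -/
theorem rwGreen_eq_tsum_exit (H : SimpleGraph (Site 2)) (B : Set (Site 2)) (a : Site 2) {b : Site 2}
    (hb : b ∉ B) :
    rwGreen H a b = ∑' z : Site 2, (∑' q : H.Walk a z,
      if (∀ v ∈ q.support.dropLast, v ∈ B) ∧ z ∉ B then ((1 : ℝ≥0∞) / 4) ^ q.length else 0) *
        rwGreen H z b := by
  simp only [rwGreen]
  exact ExitSplit.tsum_walk_eq_tsum_exit H ((1 : ℝ≥0∞) / 4) B hb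

/-- Every dart of a walk whose vertices other than the last lie in `B` has its tail in `B`.
[folklore] -/
theorem fst_mem_of_dropLast_subset {K : SimpleGraph (Site 2)} {B : Set (Site 2)} {x z : Site 2}
    (q : K.Walk x z) (hq : ∀ v ∈ q.support.dropLast, v ∈ B) :
    ∀ d ∈ q.darts, d.fst ∈ B := by
  induction q with
  | nil => simp
  | @cons u v w huv q ih =>
    intro d hd
    rw [SimpleGraph.Walk.darts_cons, List.mem_cons] at hd
    have hsupp : (SimpleGraph.Walk.cons huv q).support.dropLast = u :: q.support.dropLast := by
      rw [SimpleGraph.Walk.support_cons, List.dropLast_cons_of_ne_nil q.support_ne_nil]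
    rw [hsupp] at hq
    rcases hd with rfl | hd
    · exact hq u (List.mem_cons_self)
    · exact ih (fun v hv => hq v (List.mem_cons_of_mem u hv)) d hd

/-- **The exit weights only see the edges with an endpoint in `B`.** If two graphs have the same
edges at every vertex of `B` (`x ∈ B → (H.Adj x y ↔ H'.Adj x y)`), their exit weights out of `B`
agree: a walk whose vertices but the last lie in `B` only uses such edges. [folklore] -/
theorem tsum_exit_eq_of_adj_iff {B : Set (Site 2)}
    (hHH' : ∀ x y : Site 2, x ∈ B → (H.Adj x y ↔ H'.Adj x y)) (a z : Site 2) :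
    (∑' q : H.Walk a z, if (∀ v ∈ q.support.dropLast, v ∈ B) ∧ z ∉ B then
        ((1 : ℝ≥0∞) / 4) ^ q.length else 0) =
      ∑' q : H'.Walk a z, if (∀ v ∈ q.support.dropLast, v ∈ B) ∧ z ∉ B then
        ((1 : ℝ≥0∞) / 4) ^ q.length else 0 := by
  -- both sides are sums over the subtype of "exit walks", in bijection by `transfer`
  have key : ∀ (K K' : SimpleGraph (Site 2)), (∀ x y : Site 2, x ∈ B → (K.Adj x y → K'.Adj x y)) →
      ∀ (q : K.Walk a z), (∀ v ∈ q.support.dropLast, v ∈ B) → ∀ e ∈ q.edges, e ∈ K'.edgeSet := by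
    intro K K' hKK' q hq e he
    rw [SimpleGraph.Walk.edges, List.mem_map] at he
    obtain ⟨d, hd, rfl⟩ := he
    exact (SimpleGraph.mem_edgeSet K').2
      (hKK' _ _ (fst_mem_of_dropLast_subset q hq d hd) d.adj)
  have hL : (∑' q : H.Walk a z, if (∀ v ∈ q.support.dropLast, v ∈ B) ∧ z ∉ B then
      ((1 : ℝ≥0∞) / 4) ^ q.length else 0) =
      ∑' q : {q : H.Walk a z // (∀ v ∈ q.support.dropLast, v ∈ B) ∧ z ∉ B},
        ((1 : ℝ≥0∞) / 4) ^ q.1.length := by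
    rw [LoopErasedWalkIdentity.tsum_subtype_eq_tsum_ite (fun q : H.Walk a z =>
      (∀ v ∈ q.support.dropLast, v ∈ B) ∧ z ∉ B) (fun q => ((1 : ℝ≥0∞) / 4) ^ q.length)]
    exact tsum_congr fun q => LoopErasedWalkIdentity.ite_congr_prop _ _ Iff.rfl
  have hR : (∑' q : H'.Walk a z, if (∀ v ∈ q.support.dropLast, v ∈ B) ∧ z ∉ B then
      ((1 : ℝ≥0∞) / 4) ^ q.length else 0) =
      ∑' q : {q : H'.Walk a z // (∀ v ∈ q.support.dropLast, v ∈ B) ∧ z ∉ B},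
        ((1 : ℝ≥0∞) / 4) ^ q.1.length := by
    rw [LoopErasedWalkIdentity.tsum_subtype_eq_tsum_ite (fun q : H'.Walk a z =>
      (∀ v ∈ q.support.dropLast, v ∈ B) ∧ z ∉ B) (fun q => ((1 : ℝ≥0∞) / 4) ^ q.length)]
    exact tsum_congr fun q => LoopErasedWalkIdentity.ite_congr_prop _ _ Iff.rfl
  rw [hL, hR]
  let e : {q : H.Walk a z // (∀ v ∈ q.support.dropLast, v ∈ B) ∧ z ∉ B} ≃
      {q : H'.Walk a z // (∀ v ∈ q.support.dropLast, v ∈ B) ∧ z ∉ B} :=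
    { toFun := fun q => ⟨q.1.transfer H' (key H H' (fun x y hx => (hHH' x y hx).1) q.1 q.2.1),
        by simpa only [SimpleGraph.Walk.support_transfer] using q.2⟩
      invFun := fun q => ⟨q.1.transfer H (key H' H (fun x y hx => (hHH' x y hx).2) q.1 q.2.1),
        by simpa only [SimpleGraph.Walk.support_transfer] using q.2⟩
      left_inv := fun q => by
        apply Subtype.ext
        simp only [SimpleGraph.Walk.transfer_transfer, SimpleGraph.Walk.transfer_self]
      right_inv := fun q => by
        apply Subtype.ext
        simp only [SimpleGraph.Walk.transfer_transfer, SimpleGraph.Walk.transfer_self] }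
  rw [← e.symm.tsum_eq]
  refine tsum_congr fun q => ?_
  simp only [e, Equiv.coe_fn_symm_mk, SimpleGraph.Walk.length_transfer]

/-- **Localisation of the Green's function at the start.** If `H` and `H'` have the same edges at
every vertex of `B`, then for `b ∉ B` both Green's functions are averages of `z ↦ G(z, b)` against
the SAME exit weights `e_B(a, ·)` (computed in either graph):
`G_{H'}(a,b) = Σ_z e_B(a,z) G_{H'}(z,b)` with `e_B` the exit weights of `H`. This is the exact lattice
statement behind "the local factors at the marked point cancel in the ratio `G_{H'}/G_H`".
[cite: LawlerLimic2010, §4.6] -/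
theorem rwGreen_eq_tsum_exit_of_adj_iff {B : Set (Site 2)}
    (hHH' : ∀ x y : Site 2, x ∈ B → (H.Adj x y ↔ H'.Adj x y)) (a : Site 2) {b : Site 2}
    (hb : b ∉ B) :
    rwGreen H' a b = ∑' z : Site 2, (∑' q : H.Walk a z,
      if (∀ v ∈ q.support.dropLast, v ∈ B) ∧ z ∉ B then ((1 : ℝ≥0∞) / 4) ^ q.length else 0) *
        rwGreen H' z b := by
  rw [rwGreen_eq_tsum_exit H' B a hb]
  refine tsum_congr fun z => ?_
  rw [tsum_exit_eq_of_adj_iff hHH' a z]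

/-- **Symmetry of the killed Green's function**: `G_H(a, b) = G_H(b, a)` (reverse the walks).
[cite: Lawler2018, §2] -/
theorem rwGreen_comm (H : SimpleGraph (Site 2)) (a b : Site 2) : rwGreen H a b = rwGreen H b a := by
  rw [rwGreen, rwGreen]
  let e : H.Walk a b ≃ H.Walk b a :=
    ⟨SimpleGraph.Walk.reverse, SimpleGraph.Walk.reverse, fun ω => SimpleGraph.Walk.reverse_reverse ω,
      fun ω => SimpleGraph.Walk.reverse_reverse ω⟩
  rw [← e.tsum_eq]
  refine tsum_congr fun ω => ?_
  simp [e, SimpleGraph.Walk.length_reverse]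

end Lattice

end Summit.CriticalPhenomena.SAWScalingLimit.Theorems.AnchorExcursion

end
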